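import Literature.Topology.FourManifolds.CreaseProfile
import Literature.Topology.FourManifolds.TrisectionsChartZoneCore
import Mathlib.Analysis.SpecialFunctions.ExpDeriv
import HarnessLib

/-!
# Profiles for the middle sector's function: the weight `w`, the cap `ρ` and the radial
# correction `R₀`, with the design and radial inequalities

Topic `Literature/Topology/FourManifolds`; explicit real analysis for the fact seat
`provefact-Literature.Topology.FourManifolds.exists_isBalancedGKTrisection` (Gay–Kirby 2016,
Thm. 4 via §4, Lemma 14).  Everything in this file is **proved**; the definitions are explicit
functions `ℝ → ℝ`.

The parameters `MidParams` of the adapted function `ψ₂` on the middle sector `X₂`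
(`TrisectionsMidSectorFunction.lean`) ask for three profiles: a weight `w > 0`, non-increasing,
strictly decreasing below `b - δ_w` and constant above; a smooth non-increasing cap `ρ ≥ 0` of
`1/A` with `ρ(A) = 1/A` for `A ≥ a_R/2`; and a positive non-increasing radial correction `R₀`
with `R₀ = 1` on `[a_R', ∞)` — subject to the **design inequality** of
`TrisectionsChartZoneCore.lean` for `𝒜(a) = (η - a)(ν² + a)R₀(a)` and the **radial inequality**
of `TrisectionsMidSectorColumnModel.lean`, for all `a ∈ [0, 2a_R)` and all weight arguments.
This file constructs them (`MidProfiles.wProf`, `rhoProf`, `RProf`: crease profiles and an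
exponential) and proves the two inequalities (`MidProfiles.designIneq_holds`,
`MidProfiles.radial_holds`) under explicit numerical hypotheses on the constants: the weight is
nearly flat (`|w'| ≤ θ`, `θ` small), the radial correction is steep (`R₀'/R₀ = -K` on
`[0, a_R' - 2ε₀]`, `K` large) and flattens out only beyond `A* = (η - ν²)/2`.

## References

* D. Gay, R. Kirby, *Trisecting 4-manifolds*, Geom. Topol. 20 (2016), §4, Lemma 14. [GayKirby2016]
-/

open scoped Topology ContDiff
open Set Function Filter

noncomputable section

namespace Literature.Topology.FourManifolds

namespace MidProfiles

/-! ### The weight -/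

/-- **The weight profile** `w(t) = 1 + θ σ_{ε'}(c₁ - t)`: `= 1` for `t ≥ c₁ + ε'`, strictly
decreasing below, slope at most `θ`. [cite: GayKirby2016, §4, Lemma 14] -/
def wProf (θ ε' c₁ : ℝ) (t : ℝ) : ℝ := 1 + θ * creaseσ ε' (c₁ - t)

variable {θ ε' c₁ : ℝ}

/-- `w` is smooth. [folklore] -/
theorem contDiff_wProf : ContDiff ℝ ∞ (wProf θ ε' c₁) := by
  unfold wProf; exact contDiff_const.add (contDiff_const.mul ((contDiff_creaseσ ε').comp (contDiff_const.sub contDiff_id)))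

/-- The derivative of `w`: `w'(t) = -θ creaseStep((c₁ - t)/ε')`. [folklore] -/
theorem hasDerivAt_wProf (hε : 0 < ε') (t : ℝ) :
    HasDerivAt (wProf θ ε' c₁) (-(θ * creaseStep ((c₁ - t) / ε'))) t := by
  have hin : HasDerivAt (fun t : ℝ => c₁ - t) (-1) t := by simpa using (hasDerivAt_id t).const_sub c₁
  have hσ : HasDerivAt (fun t : ℝ => creaseσ ε' (c₁ - t)) (creaseStep ((c₁ - t) / ε') * (-1)) t :=
    (hasDerivAt_creaseσ hε (c₁ - t)).comp t hin
  have h : HasDerivAt (fun t : ℝ => 1 + θ * creaseσ ε' (c₁ - t)) (0 + θ * (creaseStep ((c₁ - t) / ε') * (-1))) t :=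
    (hasDerivAt_const t (1 : ℝ)).add (hσ.const_mul θ)
  refine (h.congr_of_eventuallyEq (Eventually.of_forall fun s => rfl)).congr_deriv ?_
  ring

/-- `deriv w`. [folklore] -/
theorem deriv_wProf (hε : 0 < ε') (t : ℝ) : deriv (wProf θ ε' c₁) t = -(θ * creaseStep ((c₁ - t) / ε')) :=
  (hasDerivAt_wProf hε t).deriv

/-- `w ≥ 1`. [folklore] -/
theorem one_le_wProf (hθ : 0 ≤ θ) (hε : 0 < ε') (t : ℝ) : 1 ≤ wProf θ ε' c₁ t := by
  unfold wProf; have := creaseσ_nonneg hε (c₁ - t); nlinarith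

/-- `w > 0`. [folklore] -/
theorem wProf_pos (hθ : 0 ≤ θ) (hε : 0 < ε') (t : ℝ) : 0 < wProf θ ε' c₁ t :=
  zero_lt_one.trans_le (one_le_wProf hθ hε t)

/-- `w' ≤ 0`. [folklore] -/
theorem deriv_wProf_nonpos (hθ : 0 ≤ θ) (hε : 0 < ε') (t : ℝ) : deriv (wProf θ ε' c₁) t ≤ 0 := by
  rw [deriv_wProf hε]; have := creaseStep_nonneg ((c₁ - t) / ε'); nlinarith

/-- `|w'| ≤ θ`. [folklore] -/
theorem abs_deriv_wProf_le (hθ : 0 ≤ θ) (hε : 0 < ε') (t : ℝ) : |deriv (wProf θ ε' c₁) t| ≤ θ := by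
  rw [deriv_wProf hε, abs_neg, abs_of_nonneg (mul_nonneg hθ (creaseStep_nonneg _))]
  have := creaseStep_le_one ((c₁ - t) / ε')
  nlinarith

/-- `w' < 0` for `t < c₁ + ε'`. [folklore] -/
theorem deriv_wProf_neg (hθ : 0 < θ) (hε : 0 < ε') {t : ℝ} (ht : t < c₁ + ε') : deriv (wProf θ ε' c₁) t < 0 := by
  rw [deriv_wProf hε]
  have : 0 < creaseStep ((c₁ - t) / ε') := creaseStep_pos (by rw [lt_div_iff₀ hε]; linarith)
  nlinarith

/-- `w = 1` for `t ≥ c₁ + ε'`. [folklore] -/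
theorem wProf_of_ge (hε : 0 < ε') {t : ℝ} (ht : c₁ + ε' ≤ t) : wProf θ ε' c₁ t = 1 := by
  unfold wProf; rw [creaseσ_of_le_neg hε (by linarith), mul_zero, add_zero]

/-! ### The cap of `1/A` -/

/-- The smoothed floor `m(a) = a_R/4 + σ_{a_R/8}(a - a_R/4)`: `≥ a_R/4`, `= a` for `a ≥ 3a_R/8`. [folklore] -/
def mFloor (aR : ℝ) (a : ℝ) : ℝ := aR / 4 + creaseσ (aR / 8) (a - aR / 4)

/-- **The cap** `ρ(a) = 1/m(a)`: `= 1/a` for `a ≥ 3a_R/8`, smooth, positive, non-increasing. [cite: GayKirby2016, §4, Lemma 14] -/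
def rhoProf (aR : ℝ) (a : ℝ) : ℝ := (mFloor aR a)⁻¹

variable {aR : ℝ}

/-- `m ≥ a_R/4`. [folklore] -/
theorem le_mFloor (haR : 0 < aR) (a : ℝ) : aR / 4 ≤ mFloor aR a := by
  unfold mFloor; have := creaseσ_nonneg (by positivity : 0 < aR / 8) (a - aR / 4); linarith

/-- `m > 0`. [folklore] -/
theorem mFloor_pos (haR : 0 < aR) (a : ℝ) : 0 < mFloor aR a := by have := le_mFloor haR a; linarith

/-- `m ≥ a`. [folklore] -/
theorem self_le_mFloor (haR : 0 < aR) (a : ℝ) : a ≤ mFloor aR a := by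
  unfold mFloor; have := le_creaseσ (by positivity : 0 < aR / 8) (a - aR / 4); linarith

/-- `m ≤ max(a, a_R/4) + a_R/8`. [folklore] -/
theorem mFloor_le (haR : 0 < aR) (a : ℝ) : mFloor aR a ≤ max a (aR / 4) + aR / 8 := by
  unfold mFloor
  have h := creaseσ_le (by positivity : 0 < aR / 8) (a - aR / 4)
  rcases le_total (a - aR / 4) 0 with h0 | h0
  · rw [max_eq_right h0] at h; rw [max_eq_right (by linarith)]; linarith
  · rw [max_eq_left h0] at h; rw [max_eq_left (by linarith)]; linarith

/-- `m = a` for `a ≥ 3a_R/8`. [folklore] -/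
theorem mFloor_of_ge (haR : 0 < aR) {a : ℝ} (ha : 3 * aR / 8 ≤ a) : mFloor aR a = a := by
  unfold mFloor; rw [creaseσ_of_le (by positivity) (by linarith)]; ring

/-- `m` is smooth. [folklore] -/
theorem contDiff_mFloor : ContDiff ℝ ∞ (mFloor aR) := by
  unfold mFloor; exact contDiff_const.add ((contDiff_creaseσ _).comp (contDiff_id.sub contDiff_const))

/-- The derivative of `m` lies in `[0, 1]`. [folklore] -/
theorem hasDerivAt_mFloor (haR : 0 < aR) (a : ℝ) :
    HasDerivAt (mFloor aR) (creaseStep ((a - aR / 4) / (aR / 8))) a := by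
  have h : HasDerivAt (fun a : ℝ => aR / 4 + creaseσ (aR / 8) (a - aR / 4)) (0 + creaseStep ((a - aR / 4) / (aR / 8))) a :=
    (hasDerivAt_const a _).add ((hasDerivAt_creaseσ (by positivity) (a - aR / 4)).comp_sub_const a (aR / 4))
  refine (h.congr_of_eventuallyEq (Eventually.of_forall fun s => rfl)).congr_deriv (zero_add _)

/-- `ρ` is smooth. [folklore] -/
theorem contDiff_rhoProf (haR : 0 < aR) : ContDiff ℝ ∞ (rhoProf aR) := by
  unfold rhoProf; exact contDiff_mFloor.inv fun a => (mFloor_pos haR a).ne'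

/-- `ρ > 0`. [folklore] -/
theorem rhoProf_pos (haR : 0 < aR) (a : ℝ) : 0 < rhoProf aR a := inv_pos.2 (mFloor_pos haR a)

/-- `ρ ≤ 4/a_R`. [folklore] -/
theorem rhoProf_le (haR : 0 < aR) (a : ℝ) : rhoProf aR a ≤ 4 / aR := by
  unfold rhoProf
  rw [inv_le_comm₀ (mFloor_pos haR a) (by positivity)]
  have := le_mFloor haR a
  rw [inv_div]; linarith

/-- `ρ = 1/a` for `a ≥ 3a_R/8`. [folklore] -/
theorem rhoProf_of_ge (haR : 0 < aR) {a : ℝ} (ha : 3 * aR / 8 ≤ a) : rhoProf aR a = a⁻¹ := by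
  unfold rhoProf; rw [mFloor_of_ge haR ha]

/-- The derivative of `ρ`: `ρ' = -m'/m²`. [folklore] -/
theorem hasDerivAt_rhoProf (haR : 0 < aR) (a : ℝ) :
    HasDerivAt (rhoProf aR) (-(creaseStep ((a - aR / 4) / (aR / 8))) / mFloor aR a ^ 2) a := by
  unfold rhoProf
  exact (hasDerivAt_mFloor haR a).inv (mFloor_pos haR a).ne'

/-- `ρ' ≤ 0`. [folklore] -/
theorem deriv_rhoProf_nonpos (haR : 0 < aR) (a : ℝ) : deriv (rhoProf aR) a ≤ 0 := by
  rw [(hasDerivAt_rhoProf haR a).deriv]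
  exact div_nonpos_of_nonpos_of_nonneg (neg_nonpos.2 (creaseStep_nonneg _)) (sq_nonneg _)

/-- **`|ρ + aρ'| ≤ 72/a_R` for `0 ≤ a ≤ 2a_R`.** [folklore] -/
theorem abs_rho_add_mul_deriv_le (haR : 0 < aR) {a : ℝ} (ha0 : 0 ≤ a) (ha : a ≤ 2 * aR) :
    |rhoProf aR a + a * deriv (rhoProf aR) a| ≤ 72 / aR := by
  rw [(hasDerivAt_rhoProf haR a).deriv]
  set m := mFloor aR a with hm
  set s := creaseStep ((a - aR / 4) / (aR / 8)) with hs
  have hm0 : aR / 4 ≤ m := le_mFloor haR a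
  have hmpos : 0 < m := mFloor_pos haR a
  have hs0 : 0 ≤ s := creaseStep_nonneg _
  have hs1 : s ≤ 1 := creaseStep_le_one _
  have hml : m ≤ 2 * aR + aR / 8 := by
    have := mFloor_le haR a
    have hmax : max a (aR / 4) ≤ 2 * aR := max_le ha (by linarith)
    linarith
  have hexpr : rhoProf aR a + a * (-s / m ^ 2) = (m - a * s) / m ^ 2 := by
    unfold rhoProf; rw [← hm]; field_simp; ring
  rw [hexpr, abs_div, abs_of_pos (pow_pos hmpos 2), div_le_div_iff₀ (pow_pos hmpos 2) haR]
  have hnum : |m - a * s| ≤ m + a := by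
    rw [abs_le]; constructor <;> nlinarith
  have h1 : |m - a * s| * aR ≤ (m + a) * aR := mul_le_mul_of_nonneg_right hnum haR.le
  have h2 : (m + a) * aR ≤ 72 * m ^ 2 := by nlinarith
  linarith

/-- On a neighbourhood of a point `a > 3a_R/8`, `ρ = 1/a`, so `ρ + aρ' = 0`. [folklore] -/
theorem rho_add_mul_deriv_eq_zero (haR : 0 < aR) {a : ℝ} (ha : 3 * aR / 8 < a) :
    rhoProf aR a + a * deriv (rhoProf aR) a = 0 := by
  have hev : rhoProf aR =ᶠ[𝓝 a] fun x => x⁻¹ := by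
    filter_upwards [Ioi_mem_nhds ha] with x hx
    exact rhoProf_of_ge haR hx.le
  have ha0 : a ≠ 0 := by have := haR; linarith
  rw [hev.deriv_eq, rhoProf_of_ge haR ha.le, deriv_inv]
  field_simp
  ring

/-! ### The radial correction -/

/-- **The radial correction** `R₀(a) = exp(K σ_{ε₀}((a_R' - ε₀) - a))`: `= 1` for `a ≥ a_R'`,
`R₀'/R₀ = -K` for `a ≤ a_R' - 2ε₀`, positive, non-increasing. [cite: GayKirby2016, §4, Lemma 14] -/
def RProf (K ε₀ aR' : ℝ) (a : ℝ) : ℝ := Real.exp (K * creaseσ ε₀ ((aR' - ε₀) - a))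

variable {K ε₀ aR' : ℝ}

/-- `R₀ > 0`. [folklore] -/
theorem RProf_pos (a : ℝ) : 0 < RProf K ε₀ aR' a := Real.exp_pos _

/-- `R₀ ≥ 1` for `K ≥ 0`. [folklore] -/
theorem one_le_RProf (hK : 0 ≤ K) (hε : 0 < ε₀) (a : ℝ) : 1 ≤ RProf K ε₀ aR' a :=
  Real.one_le_exp (mul_nonneg hK (creaseσ_nonneg hε _))

/-- `R₀` is smooth. [folklore] -/
theorem contDiff_RProf : ContDiff ℝ ∞ (RProf K ε₀ aR') := by
  unfold RProf; exact Real.contDiff_exp.comp (contDiff_const.mul ((contDiff_creaseσ ε₀).comp (contDiff_const.sub contDiff_id)))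

/-- The derivative of `R₀`: `R₀' = -K creaseStep(((a_R' - ε₀) - a)/ε₀) R₀`. [folklore] -/
theorem hasDerivAt_RProf (hε : 0 < ε₀) (a : ℝ) :
    HasDerivAt (RProf K ε₀ aR') (-(K * creaseStep (((aR' - ε₀) - a) / ε₀)) * RProf K ε₀ aR' a) a := by
  have hin : HasDerivAt (fun a : ℝ => (aR' - ε₀) - a) (-1) a := by simpa using (hasDerivAt_id a).const_sub (aR' - ε₀)
  have hσ : HasDerivAt (fun a : ℝ => creaseσ ε₀ ((aR' - ε₀) - a)) (creaseStep (((aR' - ε₀) - a) / ε₀) * (-1)) a :=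
    (hasDerivAt_creaseσ hε _).comp a hin
  have h : HasDerivAt (fun a : ℝ => Real.exp (K * creaseσ ε₀ ((aR' - ε₀) - a)))
      (Real.exp (K * creaseσ ε₀ ((aR' - ε₀) - a)) * (K * (creaseStep (((aR' - ε₀) - a) / ε₀) * (-1)))) a :=
    (hσ.const_mul K).exp
  refine (h.congr_of_eventuallyEq (Eventually.of_forall fun s => rfl)).congr_deriv ?_
  unfold RProf; ring

/-- `deriv R₀`. [folklore] -/
theorem deriv_RProf (hε : 0 < ε₀) (a : ℝ) :
    deriv (RProf K ε₀ aR') a = -(K * creaseStep (((aR' - ε₀) - a) / ε₀)) * RProf K ε₀ aR' a :=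
  (hasDerivAt_RProf hε a).deriv

/-- `R₀' ≤ 0` for `K ≥ 0`. [folklore] -/
theorem deriv_RProf_nonpos (hK : 0 ≤ K) (hε : 0 < ε₀) (a : ℝ) : deriv (RProf K ε₀ aR') a ≤ 0 := by
  rw [deriv_RProf hε]
  have := creaseStep_nonneg (((aR' - ε₀) - a) / ε₀); have := RProf_pos (K := K) (ε₀ := ε₀) (aR' := aR') a
  have : 0 ≤ K * creaseStep (((aR' - ε₀) - a) / ε₀) * RProf K ε₀ aR' a := by positivity
  linarith

/-- `R₀ = 1` for `a ≥ a_R'`. [folklore] -/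
theorem RProf_of_ge (hε : 0 < ε₀) {a : ℝ} (ha : aR' ≤ a) : RProf K ε₀ aR' a = 1 := by
  unfold RProf; rw [creaseσ_of_le_neg hε (by linarith), mul_zero, Real.exp_zero]

/-- `R₀' = -K R₀` for `a ≤ a_R' - 2ε₀`. [folklore] -/
theorem deriv_RProf_of_le (hε : 0 < ε₀) {a : ℝ} (ha : a ≤ aR' - 2 * ε₀) :
    deriv (RProf K ε₀ aR') a = -K * RProf K ε₀ aR' a := by
  rw [deriv_RProf hε, creaseStep_of_one_le (by rw [le_div_iff₀ hε]; linarith)]; ring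

/-- `-R₀' ≤ K R₀` everywhere (`K ≥ 0`). [folklore] -/
theorem neg_deriv_RProf_le (hK : 0 ≤ K) (hε : 0 < ε₀) (a : ℝ) : -deriv (RProf K ε₀ aR') a ≤ K * RProf K ε₀ aR' a := by
  rw [deriv_RProf hε, neg_mul, neg_neg]
  have hs := creaseStep_le_one (((aR' - ε₀) - a) / ε₀)
  have hR := RProf_pos (K := K) (ε₀ := ε₀) (aR' := aR') a
  have h1 : K * creaseStep (((aR' - ε₀) - a) / ε₀) ≤ K * 1 := mul_le_mul_of_nonneg_left hs hK
  have h2 := mul_le_mul_of_nonneg_right h1 hR.le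
  linarith

/-! ### The face factor `𝒜(a) = (η - a)(ν² + a) R₀(a)` and its derivative -/

variable {η ν : ℝ}

/-- The derivative of `𝒜`. [folklore] -/
theorem hasDerivAt_faceA (hε : 0 < ε₀) (a : ℝ) :
    HasDerivAt (fun a => (η - a) * (ν ^ 2 + a) * RProf K ε₀ aR' a)
      ((η - ν ^ 2 - 2 * a) * RProf K ε₀ aR' a + (η - a) * (ν ^ 2 + a) * deriv (RProf K ε₀ aR') a) a := by
  have h1 : HasDerivAt (fun a : ℝ => η - a) (-1) a := by simpa using (hasDerivAt_id a).const_sub η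
  have h2 : HasDerivAt (fun a : ℝ => ν ^ 2 + a) 1 a := by simpa using (hasDerivAt_id a).const_add (ν ^ 2)
  have h3 := hasDerivAt_RProf (K := K) (aR' := aR') hε a
  have h : HasDerivAt (fun a => (η - a) * (ν ^ 2 + a) * RProf K ε₀ aR' a)
      ((-1 * (ν ^ 2 + a) + (η - a) * 1) * RProf K ε₀ aR' a +
        (η - a) * (ν ^ 2 + a) * (-(K * creaseStep (((aR' - ε₀) - a) / ε₀)) * RProf K ε₀ aR' a)) a := (h1.mul h2).mul h3
  refine h.congr_deriv ?_
  rw [deriv_RProf hε]; ring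

/-! ### The design inequality -/

section Design

/-- Combining the pieces of the design inequality. [folklore] -/
theorem design_combine {D w P Cor Xv R : ℝ} (hDw : D * w ≤ -Xv * R) (hP : -P ≤ Cor) (hCor : Cor < Xv * R) :
    D * w - P < 0 := by linarith

/-- `D w ≤ -X R` from `D ≤ -X R`, `X R > 0`, `w ≥ 1`. [folklore] -/
theorem mul_le_of_le_neg {D w Xv R : ℝ} (h : D ≤ -Xv * R) (hXR : 0 < Xv * R) (hw : 1 ≤ w) : D * w ≤ -Xv * R := by
  have hDneg : D ≤ 0 := by linarith
  have h1 : D * w ≤ D * 1 := mul_le_mul_of_nonpos_left hw hDneg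
  linarith

variable {aR₀ kg εT : ℝ}
  (hη : 0 < η) (hν : 0 < ν) (hν2 : 2 * ν ^ 2 ≤ η) (haR : 0 < aR₀) (haR2 : 2 * aR₀ ≤ η) (hlow : (η - ν ^ 2) / 2 < aR₀)
  (hε₀ : 0 < ε₀) (haR' : aR' < aR₀) (hgap : (η - ν ^ 2) / 2 < aR' - 2 * ε₀)
  (hK : 0 ≤ K) (hK1 : 4 / ν ^ 2 ≤ K) (hθ : 0 ≤ θ) (hεw : 0 < ε') (hkg : 0 < kg) (hεT : 0 ≤ εT)
  (hθ1 : 64 * θ * kg * εT ≤ 1)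
  (hθ2 : 64 * η ^ 2 * θ * kg * εT ≤ (2 * (aR' - 2 * ε₀) - (η - ν ^ 2)) * aR₀)

include hη hν hK hK1 in
/-- The steep-zone bracket: `(η - ν² - 2a) - (η - a)(ν² + a)K ≤ -η` for `0 ≤ a ≤ η/2`, `K ≥ 4/ν²`. [folklore] -/
theorem steep_bracket_le {a : ℝ} (ha0 : 0 ≤ a) (ha : a ≤ η / 2) :
    (η - ν ^ 2 - 2 * a) - (η - a) * (ν ^ 2 + a) * K ≤ -η := by
  have hA1 : η / 2 * ν ^ 2 ≤ (η - a) * (ν ^ 2 + a) := by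
    have h1 : η / 2 ≤ η - a := by linarith
    have h2 : ν ^ 2 ≤ ν ^ 2 + a := by linarith
    exact mul_le_mul h1 h2 (by positivity) (by linarith)
  have hν0 : ν ^ 2 ≠ 0 := by positivity
  have h2η : 2 * η ≤ (η - a) * (ν ^ 2 + a) * K :=
    calc 2 * η = η / 2 * ν ^ 2 * (4 / ν ^ 2) := by field_simp; ring
      _ ≤ η / 2 * ν ^ 2 * K := mul_le_mul_of_nonneg_left hK1 (by positivity)
      _ ≤ (η - a) * (ν ^ 2 + a) * K := mul_le_mul_of_nonneg_right hA1 hK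
  have : 0 ≤ ν ^ 2 := sq_nonneg ν
  linarith

include hη hν2 haR hlow hθ hkg hεT hθ1 in
/-- The steep-zone correction is small: `8η θ k_g ε_T (η/a_R) ≤ η/2`. [folklore] -/
theorem steep_corr_le : (8 * η * θ * kg * εT) * (η / aR₀) ≤ η / 2 := by
  have hkε : 0 ≤ 8 * η * θ * kg * εT := by positivity
  have h4 : η / aR₀ ≤ 4 := by rw [div_le_iff₀ haR]; linarith
  have h1 : (8 * η * θ * kg * εT) * (η / aR₀) ≤ (8 * η * θ * kg * εT) * 4 := mul_le_mul_of_nonneg_left h4 hkε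
  have h2 : (8 * η * θ * kg * εT) * 4 = (32 * θ * kg * εT) * η := by ring
  have h3 : (32 * θ * kg * εT) * η ≤ (1 / 2) * η := mul_le_mul_of_nonneg_right (by linarith) hη.le
  linarith

include haR hθ2 in
/-- The flat-zone correction is small: `8η² θ k_g ε_T / a_R ≤ d/8`. [folklore] -/
theorem flat_corr_le : (8 * η * θ * kg * εT) * (η / aR₀) ≤ (2 * (aR' - 2 * ε₀) - (η - ν ^ 2)) / 8 := by
  rw [show (8 * η * θ * kg * εT) * (η / aR₀) = (8 * η ^ 2 * θ * kg * εT) / aR₀ by field_simp,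
    div_le_div_iff₀ haR (by norm_num : (0 : ℝ) < 8)]
  linarith

include hη hν hν2 haR haR2 hlow hε₀ haR' hgap hK hK1 hθ hεw hkg hεT hθ1 hθ2 in
/-- **The design inequality holds** for `𝒜(a) = (η - a)(ν² + a)R₀(a)`, the weight `w` and the cap
`ρ`, at every `a ∈ [0, 2a_R)` and every weight argument `t`:
`𝒜'(a) w(t) - 𝒜(a) w'(t) k_g ε_T ρ(a) < 0`.  On `[0, a_R' - 2ε₀]`:
`𝒜' = [(η - ν² - 2a) - (η - a)(ν² + a)K] R₀ ≤ -η R₀` (`K ≥ 4/ν²`), while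
`𝒜 |w'| k_g ε_T ρ ≤ 2η² · θ k_g ε_T · (4/a_R) R₀ ≤ 32 η θ k_g ε_T R₀ ≤ η R₀/2`; beyond, `R₀' ≤ 0` and
`η - ν² - 2a ≤ -(2(a_R' - 2ε₀) - (η - ν²)) < 0`. [cite: GayKirby2016, §4, Lemma 14] -/
theorem designIneq_holds {a : ℝ} (ha0 : 0 ≤ a) (ha : a < 2 * aR₀) (t : ℝ) :
    ChartZone.DesignIneq (fun a => (η - a) * (ν ^ 2 + a) * RProf K ε₀ aR' a) (wProf θ ε' c₁) (rhoProf aR₀) kg εT a t := by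
  unfold ChartZone.DesignIneq
  rw [(hasDerivAt_faceA (K := K) (aR' := aR') (η := η) (ν := ν) hε₀ a).deriv]
  have hRpos : 0 < RProf K ε₀ aR' a := RProf_pos a
  have hR'0 : deriv (RProf K ε₀ aR') a ≤ 0 := deriv_RProf_nonpos hK hε₀ a
  have hw1 : 1 ≤ wProf θ ε' c₁ t := one_le_wProf hθ hεw t
  have hw'θ : -deriv (wProf θ ε' c₁) t ≤ θ := by
    have := abs_deriv_wProf_le (c₁ := c₁) hθ hεw t; rw [abs_le] at this; linarith [this.1]
  have hρ0 : 0 < rhoProf aR₀ a := rhoProf_pos haR a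
  have hρle : rhoProf aR₀ a ≤ 4 / aR₀ := rhoProf_le haR a
  have hηa : 0 < η - a := by linarith
  have hνa : 0 < ν ^ 2 + a := by positivity
  -- `𝒜 ≤ 2η² R`
  have hA : (η - a) * (ν ^ 2 + a) * RProf K ε₀ aR' a ≤ 2 * η ^ 2 * RProf K ε₀ aR' a := by
    have h1 : (η - a) * (ν ^ 2 + a) ≤ η * (2 * η) := mul_le_mul (by linarith) (by nlinarith) hνa.le hη.le
    have := mul_le_mul_of_nonneg_right h1 hRpos.le
    linarith [show η * (2 * η) * RProf K ε₀ aR' a = 2 * η ^ 2 * RProf K ε₀ aR' a by ring]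
  -- the correction term `𝒜 |w'| kg εT ρ ≤ (8ηθkgεT)(η/aR₀) R`
  have hcorr : -((η - a) * (ν ^ 2 + a) * RProf K ε₀ aR' a * deriv (wProf θ ε' c₁) t * kg * εT * rhoProf aR₀ a) ≤
      (8 * η * θ * kg * εT) * (η / aR₀) * RProf K ε₀ aR' a := by
    have h1 : -((η - a) * (ν ^ 2 + a) * RProf K ε₀ aR' a * deriv (wProf θ ε' c₁) t * kg * εT * rhoProf aR₀ a) =
        ((η - a) * (ν ^ 2 + a) * RProf K ε₀ aR' a) * (-deriv (wProf θ ε' c₁) t) * (kg * εT) * rhoProf aR₀ a := by ring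
    rw [h1]
    have hA0 : 0 ≤ (η - a) * (ν ^ 2 + a) * RProf K ε₀ aR' a := by positivity
    have hkε : 0 ≤ kg * εT := by positivity
    have hw'0 : 0 ≤ -deriv (wProf θ ε' c₁) t := by linarith [deriv_wProf_nonpos (c₁ := c₁) hθ hεw t]
    calc ((η - a) * (ν ^ 2 + a) * RProf K ε₀ aR' a) * (-deriv (wProf θ ε' c₁) t) * (kg * εT) * rhoProf aR₀ a
        ≤ (2 * η ^ 2 * RProf K ε₀ aR' a) * θ * (kg * εT) * (4 / aR₀) := by
          apply mul_le_mul _ hρle hρ0.le (by positivity)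
          apply mul_le_mul_of_nonneg_right _ hkε
          exact mul_le_mul hA hw'θ hw'0 (by positivity)
      _ = (8 * η * θ * kg * εT) * (η / aR₀) * RProf K ε₀ aR' a := by ring
  rcases le_or_gt a (aR' - 2 * ε₀) with hle | hgt
  · -- steep zone: `R' = -K R`
    have hR'eq : deriv (RProf K ε₀ aR') a = -K * RProf K ε₀ aR' a := deriv_RProf_of_le hε₀ hle
    have hbr := steep_bracket_le hη hν hK hK1 ha0 (by linarith)
    have hDle : (η - ν ^ 2 - 2 * a) * RProf K ε₀ aR' a + (η - a) * (ν ^ 2 + a) * deriv (RProf K ε₀ aR') a ≤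
        -η * RProf K ε₀ aR' a := by
      rw [hR'eq]
      have := mul_le_mul_of_nonneg_right hbr hRpos.le
      linarith [show (η - ν ^ 2 - 2 * a - (η - a) * (ν ^ 2 + a) * K) * RProf K ε₀ aR' a =
        (η - ν ^ 2 - 2 * a) * RProf K ε₀ aR' a + (η - a) * (ν ^ 2 + a) * (-K * RProf K ε₀ aR' a) by ring]
    have hXR : 0 < η * RProf K ε₀ aR' a := mul_pos hη hRpos
    refine design_combine (mul_le_of_le_neg hDle hXR hw1) hcorr ?_
    have := mul_le_mul_of_nonneg_right (steep_corr_le hη hν2 haR hlow hθ hkg hεT hθ1) hRpos.le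
    nlinarith
  · -- flat-ish zone: `a > aR' - 2ε₀ > A*`, `R' ≤ 0`
    have hdpos : 0 < 2 * (aR' - 2 * ε₀) - (η - ν ^ 2) := by linarith
    have hDle : (η - ν ^ 2 - 2 * a) * RProf K ε₀ aR' a + (η - a) * (ν ^ 2 + a) * deriv (RProf K ε₀ aR') a ≤
        -(2 * (aR' - 2 * ε₀) - (η - ν ^ 2)) * RProf K ε₀ aR' a := by
      have h1 : (η - a) * (ν ^ 2 + a) * deriv (RProf K ε₀ aR') a ≤ 0 := mul_nonpos_of_nonneg_of_nonpos (by positivity) hR'0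
      have h2 : (η - ν ^ 2 - 2 * a) ≤ -(2 * (aR' - 2 * ε₀) - (η - ν ^ 2)) := by linarith
      have h3 := mul_le_mul_of_nonneg_right h2 hRpos.le
      linarith
    have hXR : 0 < (2 * (aR' - 2 * ε₀) - (η - ν ^ 2)) * RProf K ε₀ aR' a := mul_pos hdpos hRpos
    refine design_combine (mul_le_of_le_neg hDle hXR hw1) hcorr ?_
    have := mul_le_mul_of_nonneg_right (flat_corr_le (kg := kg) (εT := εT) (θ := θ) haR hθ2) hRpos.le
    nlinarith

end Design

/-! ### The radial inequality -/

section Radial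

variable {aR₀ kg εT κT : ℝ}
  (haR : 0 < aR₀) (hε₀ : 0 < ε₀) (h38 : 3 * aR₀ / 8 ≤ aR' - 2 * ε₀)
  (hK : 0 ≤ K) (hK2 : εT * θ * kg * 72 ≤ K * aR₀) (hθ : 0 ≤ θ) (hεw : 0 < ε') (hkg : 0 ≤ kg) (hεT : 0 ≤ εT)
  (hκ : 0 ≤ κT / η)

include haR hε₀ h38 hK hK2 hθ hεw hkg hεT hκ in
/-- **The radial inequality holds** at every `a ∈ [0, 2a_R)` and every weight argument `t`:
`ε_T a (ρ + aρ') |w'| k_g R₀ ≤ a w (-R₀') + a² (κ_T/η) |w'| k_g R₀`.  For `a > 3a_R/8`,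
`ρ + aρ' = 0`; below, `-R₀' = K R₀` and `|ρ + aρ'| ≤ 72/a_R`, so `K a_R ≥ 72 ε_T θ k_g` suffices
(`w ≥ 1`). [cite: GayKirby2016, §4, Lemma 14] -/
theorem radial_holds {a : ℝ} (ha0 : 0 ≤ a) (ha : a < 2 * aR₀) (t : ℝ) :
    εT * a * (rhoProf aR₀ a + a * deriv (rhoProf aR₀) a) * |deriv (wProf θ ε' c₁) t| * kg * RProf K ε₀ aR' a ≤
      a * wProf θ ε' c₁ t * (-deriv (RProf K ε₀ aR') a) +
        a ^ 2 * (κT / η) * |deriv (wProf θ ε' c₁) t| * kg * RProf K ε₀ aR' a := by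
  set R := RProf K ε₀ aR' a
  have hRpos : 0 < R := RProf_pos a
  have hR'0 : 0 ≤ -deriv (RProf K ε₀ aR') a := by linarith [deriv_RProf_nonpos (aR' := aR') hK hε₀ a]
  have hw1 : 1 ≤ wProf θ ε' c₁ t := one_le_wProf hθ hεw t
  have hw'θ : |deriv (wProf θ ε' c₁) t| ≤ θ := abs_deriv_wProf_le hθ hεw t
  have hw'0 : 0 ≤ |deriv (wProf θ ε' c₁) t| := abs_nonneg _
  have hRHS2 : 0 ≤ a ^ 2 * (κT / η) * |deriv (wProf θ ε' c₁) t| * kg * R := by positivity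
  have hRHS1 : 0 ≤ a * wProf θ ε' c₁ t * (-deriv (RProf K ε₀ aR') a) := by
    have : 0 ≤ wProf θ ε' c₁ t := by linarith
    positivity
  rcases lt_or_ge (3 * aR₀ / 8) a with hgt | hle
  · rw [rho_add_mul_deriv_eq_zero haR hgt]
    simp only [mul_zero, zero_mul]
    linarith
  · -- steep zone: `-R' = K R`
    have hR'eq : -deriv (RProf K ε₀ aR') a = K * R := by
      rw [deriv_RProf_of_le hε₀ (hle.trans h38)]; ring
    have hE : |rhoProf aR₀ a + a * deriv (rhoProf aR₀) a| ≤ 72 / aR₀ := abs_rho_add_mul_deriv_le haR ha0 ha.le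
    set E := rhoProf aR₀ a + a * deriv (rhoProf aR₀) a with hEdef
    set N := |deriv (wProf θ ε' c₁) t| * kg * R with hN
    have hN0 : 0 ≤ N := by positivity
    have hεa : 0 ≤ εT * a := by positivity
    have hkR : 0 ≤ kg * R := by positivity
    -- `LHS ≤ εT a (72/aR₀) θ kg R`
    have hNle : N ≤ θ * (kg * R) := by
      rw [hN, mul_assoc]; exact mul_le_mul_of_nonneg_right hw'θ hkR
    have hEN : E * N ≤ (72 / aR₀) * (θ * (kg * R)) :=
      calc E * N ≤ |E| * N := mul_le_mul_of_nonneg_right (le_abs_self E) hN0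
        _ ≤ (72 / aR₀) * N := mul_le_mul_of_nonneg_right hE hN0
        _ ≤ (72 / aR₀) * (θ * (kg * R)) := mul_le_mul_of_nonneg_left hNle (by positivity)
    have hlhs : εT * a * E * |deriv (wProf θ ε' c₁) t| * kg * R ≤ εT * a * ((72 / aR₀) * (θ * (kg * R))) := by
      have h1 : εT * a * E * |deriv (wProf θ ε' c₁) t| * kg * R = (εT * a) * (E * N) := by rw [hN]; ring
      rw [h1]
      exact mul_le_mul_of_nonneg_left hEN hεa
    -- `εT a (72/aR₀) θ kg R ≤ a K R ≤ a w (-R')`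
    have hK' : εT * (72 / aR₀) * θ * kg ≤ K := by
      rw [show εT * (72 / aR₀) * θ * kg = (εT * θ * kg * 72) / aR₀ by ring, div_le_iff₀ haR]; exact hK2
    have hrhs : εT * a * ((72 / aR₀) * (θ * (kg * R))) ≤ a * wProf θ ε' c₁ t * (-deriv (RProf K ε₀ aR') a) := by
      rw [hR'eq]
      have haR0 : 0 ≤ a * R := by positivity
      have h1 : εT * a * ((72 / aR₀) * (θ * (kg * R))) = (a * R) * (εT * (72 / aR₀) * θ * kg) := by ring
      have h2 : (a * R) * (εT * (72 / aR₀) * θ * kg) ≤ (a * R) * K := mul_le_mul_of_nonneg_left hK' haR0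
      have h3 : (a * R) * K ≤ (a * R) * K * wProf θ ε' c₁ t := by
        have : 0 ≤ (a * R) * K := by positivity
        exact le_mul_of_one_le_right this hw1
      have h4 : (a * R) * K * wProf θ ε' c₁ t = a * wProf θ ε' c₁ t * (K * R) := by ring
      linarith
    linarith

end Radial

end MidProfiles

end Literature.Topology.FourManifolds

end
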